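import Summits.QuantumFields.YangMills.Theorems.FluctuationComparisonRegPrIntLS2BetaStratumBodyGaugeWLOG
import HarnessLib

/-!
# S2β · GAP♯∘ — «THE TRIPLE BODY DOOR»: the stratum gap body at `(V, U₀, U)` ⟺ the body at the simultaneously re-gauged triple `(u•V, û•U₀, û•U)`,
# `û := liftTransfTo u` the lift of a COARSE gauge transformation `u` — ✓`gapStratum_of_goodGauge`'s inner inequality run both ways, stated at the BODY level

Cell `ym3-torus` (rung R3 = continuum `SU(2)` YM₃ on T³ at fixed lattice data — NOT d = 4, NOT infinite volume, NOT a mass gap, NOT Clay).  Width seat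
`ym3-torus-px16` (gen 24); crux `stmt-QuantumFields-20520` `FluctuationComparisonRegPrIntL`, LINE g18-1 S2β (registry untouched); organ GAP♯∘.  (RES-u) of record
(architect px17 g23 2026-09-01T01:09Z «TRIPLE MOVE + COMMUTATOR LETTER», desk №704; w5 g28 01:13Z «yours, sibling»): Thm 2's restricted gauge `u` splits as
`u = ǔ·r`, `r` residual (door ✓`…S2BetaBodyRebaseResidual`, the sibling of this file) and `ǔ` the lift of a coarse transformation; THIS FILE is the door for
the `ǔ`-half: the body `μ·L^{−2(K−J)}·⨅_{w residual} d²(U, w•U₀) ≤ A(U) − A_min(V)` is INVARIANT under `(V, U₀, U) ↦ (u•V, û•U₀, û•U)` — the action and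
`A_min` are invariant (✓`wilsonAction4_gaugeAct`, lit ✓`minActionRegPr_gaugeAct`), and the residual-orbit infimum is carried by the conjugation `w ↦ û⁻¹·w·û`
(✓`residual_conj_liftTransfTo`, ✓`sum_dist1_sq_gaugeAct`, ✓`gaugeAct_gaugeAct_conj`, ✓`iInf_orbitDistSq_le_of_residual`) — ✓p822838∕✓`gapStratum_of_goodGauge`'s
algebra, run with `u` and with `u⁻¹` (`liftTransfTo u⁻¹ = (liftTransfTo u)⁻¹` pointwise).
* §1 `liftTransfTo_inv`; ★`iInf_orbitDistSq_le_triple` (one direction), ★`iInf_orbitDistSq_triple` (equality);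
* §2 ★★`body_triple_iff (hε₀ : 0 ≤ ε₀) (u) : BODY(u•V, û•U₀, û•U) ↔ BODY(V, U₀, U)` (BODY = ✓p838507's conclusion tail VERBATIM) + the USE form;
  admissibility of the moved triple is ALREADY on the tree: ✓`mem_argmin_gaugeAct_liftTransfTo`, ✓`mem_fibre_gaugeAct_liftTransfTo`, ✓`gaugeAct_mem_histGood_iff`,
  ✓`plaqSmall_gaugeAct_iff'` (cited by name, not restated).
`--kind proof --supports stmt-QuantumFields-20520 --as helper`, count-neutral, DEFINITION-FREE (0 `def`, 0 `instance`, 0 `sorry`; default heartbeats).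

HONEST.  Gauge-covariance plumbing over landed lemmas; the commutator letter (RES-u.4), (RES-u.0), (REG), «GAUGE-REP», hsupp, hD, hDBX are OPEN ∕ HYPOTHESES elsewhere;
nothing of Bałaban's analysis asserted ([Balaban1985Variational] p.278 «𝔘_k is gauge invariant», (3)–(4) p.278, Thm 1 (8)–(10) p.279); GAP♯∘ (`stub_uniformFibreGapOrbit`,
0∕5), the five REGISTERED stubs, S2β, crux 20520, 19936, 19200, `YM3TorusSU2` NOT proved; rung R3 = SU(2) YM₃ on T³ — NOT d = 4, NOT infinite volume, NOT a mass
gap, NOT Clay; the Yang–Mills mass gap is NOT proved.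
-/

set_option autoImplicit false

noncomputable section

namespace Summit.QuantumFields.YangMills.Theorems.FluctuationComparisonRegPrIntLS2BetaBodyRebaseTriple

open Finset
open Literature.MathematicalPhysics.QuantumFieldTheory.Balaban1983to89
open T4Continuum T3ContinuumYM3Torus T3UnitScaleTilt T3TiltDescent T3LevelShift
open T3UnitLawDensityEML (ℰp)
open T3ConstrainedMinimiser (fibre)
open T3PrintedRegularMinimiser (minActionRegPr)
open T3PrintedRegularOrbits (liftTransfTo minActionRegPr_gaugeAct)
open Summit.QuantumFields.YangMills.Theorems.FluctuationComparisonRegPrIntLS2BetaResidualGauge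
  (gaugeAct_inv_gaugeAct residual_one wilsonAction4_gaugeAct)
open Summit.QuantumFields.YangMills.Theorems.FluctuationComparisonRegPrIntLS2BetaOrbitDistComparison
  (sum_dist1_sq_gaugeAct iInf_orbitDistSq_le_of_residual)
open Summit.QuantumFields.YangMills.Theorems.FluctuationComparisonRegPrIntLS2BetaDatumGaugeWLOG
  (gaugeAct_gaugeAct_conj residual_conj_liftTransfTo)

variable (F : T3Family) {J K : ℕ} (hJK : J ≤ K)

/-! ## §1 The residual-orbit infimum is carried along the triple move -/

/-- The lift is pointwise, so it commutes with inversion: `liftTransfTo u⁻¹ = (liftTransfTo u)⁻¹`. [cite: Balaban1985Averaging, (12) p.19] -/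
theorem liftTransfTo_inv (u : Site (F.P J) 0 → Matrix.specialUnitaryGroup (Fin 2) ℂ) :
    liftTransfTo F J K hJK (u⁻¹ : Site (F.P J) 0 → Matrix.specialUnitaryGroup (Fin 2) ℂ) =
      ((liftTransfTo F J K hJK u : Site (F.P K) 0 → Matrix.specialUnitaryGroup (Fin 2) ℂ)⁻¹ : Site (F.P K) 0 → Matrix.specialUnitaryGroup (Fin 2) ℂ) := by
  funext z
  rfl

/-- ★ ONE DIRECTION: `⨅_{w residual} d²(U, w•U₀) ≤ ⨅_{w residual} d²(û•U, w•(û•U₀))`, `û := liftTransfTo u` — test the left infimum at `û⁻¹·w·û`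
(residual, ✓`residual_conj_liftTransfTo`) and conjugate (✓`sum_dist1_sq_gaugeAct`, ✓`gaugeAct_gaugeAct_conj`).  (= the inner step of ✓`gapStratum_of_goodGauge`.)
[cite: Balaban1985Variational, Thm 1 (8)-(10) p.279, (4) p.278] -/
theorem iInf_orbitDistSq_le_triple (u : Site (F.P J) 0 → Matrix.specialUnitaryGroup (Fin 2) ℂ)
    (U U₀ : GaugeField (F.P K) 0 (Matrix.specialUnitaryGroup (Fin 2) ℂ)) :
    (⨅ w : {w : GaugeTransf (F.P K) 0 (Matrix.specialUnitaryGroup (Fin 2) ℂ) | ∀ U : GaugeField (F.P K) 0 (Matrix.specialUnitaryGroup (Fin 2) ℂ),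
          descendTo F ℰp J K hJK (GaugeField.gaugeAct w U) = descendTo F ℰp J K hJK U}, ∑ ℓ : PBond (F.P K) 0,
        dist1 (U ℓ * ((GaugeField.gaugeAct (w : GaugeTransf (F.P K) 0 (Matrix.specialUnitaryGroup (Fin 2) ℂ)) U₀) ℓ)⁻¹) ^ 2) ≤
      ⨅ w : {w : GaugeTransf (F.P K) 0 (Matrix.specialUnitaryGroup (Fin 2) ℂ) | ∀ U : GaugeField (F.P K) 0 (Matrix.specialUnitaryGroup (Fin 2) ℂ),
          descendTo F ℰp J K hJK (GaugeField.gaugeAct w U) = descendTo F ℰp J K hJK U}, ∑ ℓ : PBond (F.P K) 0,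
        dist1 ((GaugeField.gaugeAct (liftTransfTo F J K hJK u) U) ℓ *
          ((GaugeField.gaugeAct (w : GaugeTransf (F.P K) 0 (Matrix.specialUnitaryGroup (Fin 2) ℂ)) (GaugeField.gaugeAct (liftTransfTo F J K hJK u) U₀)) ℓ)⁻¹) ^ 2 := by
  haveI : Nonempty {w : GaugeTransf (F.P K) 0 (Matrix.specialUnitaryGroup (Fin 2) ℂ) | ∀ U : GaugeField (F.P K) 0 (Matrix.specialUnitaryGroup (Fin 2) ℂ),
      descendTo F ℰp J K hJK (GaugeField.gaugeAct w U) = descendTo F ℰp J K hJK U} := ⟨⟨fun _ => 1, residual_one F hJK⟩⟩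
  refine le_ciInf fun w => ?_
  have hw' := residual_conj_liftTransfTo F hJK u w.2
  refine (iInf_orbitDistSq_le_of_residual F hJK U U₀ hw').trans (le_of_eq ?_)
  rw [← sum_dist1_sq_gaugeAct (liftTransfTo F J K hJK u) U, gaugeAct_gaugeAct_conj]

/-- ★ **THE RESIDUAL-ORBIT INFIMUM IS INVARIANT UNDER THE TRIPLE MOVE**: `⨅_w d²(û•U, w•(û•U₀)) = ⨅_w d²(U, w•U₀)` (§1 with `u` and with `u⁻¹`).
[cite: Balaban1985Variational, Thm 1 (8)-(10) p.279, (4) p.278] -/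
theorem iInf_orbitDistSq_triple (u : Site (F.P J) 0 → Matrix.specialUnitaryGroup (Fin 2) ℂ)
    (U U₀ : GaugeField (F.P K) 0 (Matrix.specialUnitaryGroup (Fin 2) ℂ)) :
    (⨅ w : {w : GaugeTransf (F.P K) 0 (Matrix.specialUnitaryGroup (Fin 2) ℂ) | ∀ U : GaugeField (F.P K) 0 (Matrix.specialUnitaryGroup (Fin 2) ℂ),
          descendTo F ℰp J K hJK (GaugeField.gaugeAct w U) = descendTo F ℰp J K hJK U}, ∑ ℓ : PBond (F.P K) 0,
        dist1 ((GaugeField.gaugeAct (liftTransfTo F J K hJK u) U) ℓ *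
          ((GaugeField.gaugeAct (w : GaugeTransf (F.P K) 0 (Matrix.specialUnitaryGroup (Fin 2) ℂ)) (GaugeField.gaugeAct (liftTransfTo F J K hJK u) U₀)) ℓ)⁻¹) ^ 2) =
      ⨅ w : {w : GaugeTransf (F.P K) 0 (Matrix.specialUnitaryGroup (Fin 2) ℂ) | ∀ U : GaugeField (F.P K) 0 (Matrix.specialUnitaryGroup (Fin 2) ℂ),
          descendTo F ℰp J K hJK (GaugeField.gaugeAct w U) = descendTo F ℰp J K hJK U}, ∑ ℓ : PBond (F.P K) 0,
        dist1 (U ℓ * ((GaugeField.gaugeAct (w : GaugeTransf (F.P K) 0 (Matrix.specialUnitaryGroup (Fin 2) ℂ)) U₀) ℓ)⁻¹) ^ 2 := by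
  apply le_antisymm
  · -- move back with `u⁻¹`
    have h := iInf_orbitDistSq_le_triple F hJK (u⁻¹ : Site (F.P J) 0 → Matrix.specialUnitaryGroup (Fin 2) ℂ)
      (GaugeField.gaugeAct (liftTransfTo F J K hJK u) U) (GaugeField.gaugeAct (liftTransfTo F J K hJK u) U₀)
    rwa [liftTransfTo_inv, gaugeAct_inv_gaugeAct, gaugeAct_inv_gaugeAct] at h
  · exact iInf_orbitDistSq_le_triple F hJK u U U₀

/-! ## §2 The triple body door -/

/-- ★★ **THE TRIPLE BODY DOOR**: for any coarse gauge transformation `u` (lift `û := liftTransfTo u`) and `ε₀ ≥ 0`, the GAP♯∘ body (✓p838507's conclusion tail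
VERBATIM) at the moved triple `(u•V, û•U₀, û•U)` ⟺ at `(V, U₀, U)`.  Admissibility companions on the tree: ✓`mem_argmin_gaugeAct_liftTransfTo`,
✓`mem_fibre_gaugeAct_liftTransfTo`, ✓`gaugeAct_mem_histGood_iff`, ✓`plaqSmall_gaugeAct_iff'`. [cite: Balaban1985Variational, p.278, Thm 1 (8)-(10) p.279] -/
theorem body_triple_iff {ε₀ : ℝ} (hε₀ : 0 ≤ ε₀) (u : Site (F.P J) 0 → Matrix.specialUnitaryGroup (Fin 2) ℂ) (μ : ℝ)
    (V : GaugeField (F.P J) 0 (Matrix.specialUnitaryGroup (Fin 2) ℂ)) (U₀ U : GaugeField (F.P K) 0 (Matrix.specialUnitaryGroup (Fin 2) ℂ)) :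
    (μ * ((F.L : ℝ)⁻¹) ^ (2 * (K - J)) *
          (⨅ w : {w : GaugeTransf (F.P K) 0 (Matrix.specialUnitaryGroup (Fin 2) ℂ) | ∀ U : GaugeField (F.P K) 0 (Matrix.specialUnitaryGroup (Fin 2) ℂ),
              descendTo F ℰp J K hJK (GaugeField.gaugeAct w U) = descendTo F ℰp J K hJK U}, ∑ ℓ : PBond (F.P K) 0,
            dist1 ((GaugeField.gaugeAct (liftTransfTo F J K hJK u) U) ℓ *
              ((GaugeField.gaugeAct (w : GaugeTransf (F.P K) 0 (Matrix.specialUnitaryGroup (Fin 2) ℂ)) (GaugeField.gaugeAct (liftTransfTo F J K hJK u) U₀)) ℓ)⁻¹) ^ 2)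
        ≤ wilsonAction4 (GaugeField.gaugeAct (liftTransfTo F J K hJK u) U) - minActionRegPr F J K hJK ε₀ (GaugeField.gaugeAct u V)) ↔
      (μ * ((F.L : ℝ)⁻¹) ^ (2 * (K - J)) *
          (⨅ w : {w : GaugeTransf (F.P K) 0 (Matrix.specialUnitaryGroup (Fin 2) ℂ) | ∀ U : GaugeField (F.P K) 0 (Matrix.specialUnitaryGroup (Fin 2) ℂ),
              descendTo F ℰp J K hJK (GaugeField.gaugeAct w U) = descendTo F ℰp J K hJK U}, ∑ ℓ : PBond (F.P K) 0,
            dist1 (U ℓ * ((GaugeField.gaugeAct (w : GaugeTransf (F.P K) 0 (Matrix.specialUnitaryGroup (Fin 2) ℂ)) U₀) ℓ)⁻¹) ^ 2)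
        ≤ wilsonAction4 U - minActionRegPr F J K hJK ε₀ V) := by
  rw [iInf_orbitDistSq_triple F hJK u U U₀, wilsonAction4_gaugeAct, minActionRegPr_gaugeAct F hJK hε₀]

/-- USE FORM: the body at `(V, U₀, U)` from the body at the moved triple. [cite: Balaban1985Variational, Thm 1 (8)-(10) p.279] -/
theorem body_of_body_triple {ε₀ : ℝ} (hε₀ : 0 ≤ ε₀) (u : Site (F.P J) 0 → Matrix.specialUnitaryGroup (Fin 2) ℂ) {μ : ℝ}
    {V : GaugeField (F.P J) 0 (Matrix.specialUnitaryGroup (Fin 2) ℂ)} {U₀ U : GaugeField (F.P K) 0 (Matrix.specialUnitaryGroup (Fin 2) ℂ)}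
    (h : μ * ((F.L : ℝ)⁻¹) ^ (2 * (K - J)) *
          (⨅ w : {w : GaugeTransf (F.P K) 0 (Matrix.specialUnitaryGroup (Fin 2) ℂ) | ∀ U : GaugeField (F.P K) 0 (Matrix.specialUnitaryGroup (Fin 2) ℂ),
              descendTo F ℰp J K hJK (GaugeField.gaugeAct w U) = descendTo F ℰp J K hJK U}, ∑ ℓ : PBond (F.P K) 0,
            dist1 ((GaugeField.gaugeAct (liftTransfTo F J K hJK u) U) ℓ *
              ((GaugeField.gaugeAct (w : GaugeTransf (F.P K) 0 (Matrix.specialUnitaryGroup (Fin 2) ℂ)) (GaugeField.gaugeAct (liftTransfTo F J K hJK u) U₀)) ℓ)⁻¹) ^ 2)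
        ≤ wilsonAction4 (GaugeField.gaugeAct (liftTransfTo F J K hJK u) U) - minActionRegPr F J K hJK ε₀ (GaugeField.gaugeAct u V)) :
    μ * ((F.L : ℝ)⁻¹) ^ (2 * (K - J)) *
          (⨅ w : {w : GaugeTransf (F.P K) 0 (Matrix.specialUnitaryGroup (Fin 2) ℂ) | ∀ U : GaugeField (F.P K) 0 (Matrix.specialUnitaryGroup (Fin 2) ℂ),
              descendTo F ℰp J K hJK (GaugeField.gaugeAct w U) = descendTo F ℰp J K hJK U}, ∑ ℓ : PBond (F.P K) 0,
            dist1 (U ℓ * ((GaugeField.gaugeAct (w : GaugeTransf (F.P K) 0 (Matrix.specialUnitaryGroup (Fin 2) ℂ)) U₀) ℓ)⁻¹) ^ 2)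
        ≤ wilsonAction4 U - minActionRegPr F J K hJK ε₀ V :=
  (body_triple_iff F hJK hε₀ u μ V U₀ U).mp h

end Summit.QuantumFields.YangMills.Theorems.FluctuationComparisonRegPrIntLS2BetaBodyRebaseTriple

end
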